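import Mathlib
import HarnessLib
import HarnessLib.Audit
import Summits.NavierStokesRegularity.Statement
import Literature.Analysis.FluidPDE.ClassicalSolution
import Literature.Analysis.FluidPDE.LerayHopf
import Literature.Analysis.FluidPDE.NSWave0
import Literature.Analysis.FluidPDE.AxisymmetricEuler
import Literature.Analysis.FluidPDE.SelfSimilar
import Summits.NavierStokesRegularity.NavierStokesRegularity.Theorems.CertifiedBlowupAssembly
import Summits.NavierStokesRegularity.NavierStokesRegularity.Theorems.AdiabaticEddyClayUniqueness

/-!
Route: SwirlThreshold

DORMANT since 2026-09-03T16:18:48Z (reconciler: no traction for 5 d (last activity item-evidence-added at 2026-08-29T15:29:42Z); parked, not closed — `ledger route dormant route-NavierStokesRegularity-SwirlThreshold --off` to reactivate) — unstaffed, not closed; items shared with open routes are served there. `ledger route dormant <id> --off` reactivates.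

# Route SwirlThreshold — NavierStokesRegularity, TWO-SIDED scenario route on the
axisymmetric-with-swirl class; summit-bearing spine NEGATIVE (¬A)
Card realised: NavierStokesRegularity/NavierStokesRegularity/swirl-threshold-induction.

## Thesis X ("it suffices to show") = AxisymBlowup ∧ ClayUniqueness
AxisymBlowup (= X5a_axi, stmt-NavierStokesRegularity-0727, shared with route CertifiedBlowup): for
some ν>0 a finite-energy (Leray–Hopf) classical NS solution from a rapidly decaying AXISYMMETRIC
datum admits no classical extension past some T<∞. ClayUniqueness (= X5b,
stmt-NavierStokesRegularity-0153, shared). Lean: both verbatim the shared signatures (they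
de-duplicate onto 0727/0153); Assembly `AxisymBlowup → ClayUniqueness → ¬NavierStokesRegularity` is
PROVED in the planner's Sketch.lean in one line from the accepted glue
Literature.NS.certifiedBlowup_assembly_v2 (stmt-0726).

Deciding theorem (rev 2, native audit OK, negative spine): `closes : SmallSwirlRegularity →
SwirlCriticalLiouville → AxisymBlowup → SwirlThresholdZoom → ClayUniqueness → SwirlSupStrictDecrease
→ SmallSwirlFailureBlowup → Assembly → ¬NavierStokesRegularity`, proof
`Literature.NS.certifiedBlowup_assembly_v2 ⟨AxisymBlowup, ClayUniqueness⟩` — only the two spine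
items are used; the other hypotheses are the two-sided analysis of AxisymBlowup and are carried, not
consumed.

## The line of attack: the swirl threshold Re_c (an ALTERNATIVE DECOMPOSITION of AxisymBlowup;
D-0019 §6: separate route sharing the decl)
In the axisymmetric class — the habitat of Hou's interior candidate (Hou2022PotentiallySingularNS;
Hou2026) — Navier–Stokes carries a controlled CRITICAL quantity: the swirl Γ = r u_θ (in-tree
`Literature.Analysis.FluidPDE.swirl`) has scale-invariant sup-norm and obeys ∂_tΓ + b·∇Γ = ν(Δ −
(2/r)∂_r)Γ (in-tree theorem `swirl_transport_holds`), hence a maximum principle and, because Γ = 0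
on the axis and Γ(t) → 0 at infinity, a STRONG one: t ↦ sup_x|Γ(t,x)| is strictly decreasing along
every classical solution with swirl (support SwirlSupStrictDecrease). With Re_c := ν⁻¹·inf{
sup_x|Γ(u(t),x)| : (u,p,T) a witness of AxisymBlowup, t ∈ [0,T) } ∈ [0,∞] one has AxisymBlowup ⇔
Re_c < ∞, the infimum is never attained, and sup|Γ| > ν·Re_c at every instant of every axisymmetric
blow-up ("swirl cannot be used up before the singularity"). The route attacks Re_c from both ends
with typed, independently decidable statements:
 (i) SmallSwirlRegularity (crux, rank 2): Re_c > 0 with an ABSOLUTE constant — ∃ ε>0 ∀ν>0: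
sup|Γ(u₀)| ≤ εν ⇒ no blow-up. Not in print: every small-swirl theorem is relative to other norms of
the datum (LeiZhang2017 Thm 1.4, LiuZhang2017, NowakowskiZajaczkowski2023). Its NEGATION implies
AxisymBlowup (support SmallSwirlFailureBlowup, proved in Sketch.lean) — informative both ways.
 (ii) SwirlCriticalLiouville (crux, rank 3): the forced shape of a swirl-minimal singularity model —
a bounded ancient mild axisymmetric solution whose swirl supremum is the SAME constant L>0 on every
time slice and is attained on none (the reservoir sits at spatial infinity; Lei–Ren–Zhang prove
limsup_{r→∞}|Γ| = sup|Γ| for bounded ancient solutions) — does not exist. A strictly weaker special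
case of the in-tree open problem AX-L
(`Literature.Analysis.FluidPDE.AxisymmetricLiouvilleBoundedSwirl`, hence of (L), TypeILiouville crux
stmt-0057; the ~40-line reduction AX-L ⇒ (ii) is deliberately NOT an item since rev 2 — naming the
cite-only AX-L inside an item made the cone unstaffable — and may land as a `--supports` lemma),
isolating Zhang–Pan's "remaining, most difficult case: Γ does not decay near infinity" with the
extra structure the threshold forces (positive deficit L − |Γ|, constant-in-time sup).
 (iii) AxisymBlowup itself (crux, rank 4, shared; construction/certification side): a certified
axisymmetric witness at swirl number S gives Re_c ≤ S; Hou's explicit datum gives the marker Re_Hou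
= sup|r u₀^θ|/ν (arXiv:2107.06509 §2) that refuters can compute, and (T1) is a necessary condition
testable on Hou's run.
 (iv) SwirlThresholdZoom (crux, rank 5, INFORMAL, filed after open): AxisymBlowup ⇒ a swirl-critical
ancient element as in (ii) exists (compactness at the threshold via the rate-free KNSS sup-zoom).
(iv) ∧ (ii) ⇒ ¬AxisymBlowup: the kill direction of this route, which would also BREAK route
CertifiedBlowup through the proved kill edge stmt-0729 — recorded here, not hidden.
Lean: (i) ∃ ε>0, ∀ ν T>0, ∀ u p, IsClassicalNSSolutionOn (Ico 0 T) ν 0 u p → IsLerayHopfOn T ν 0 (u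
0) u → HasRapidSpatialDecay (u 0) → IsAxisymmetric (u 0) → (∀ x, |swirl (u 0) x| ≤ ε*ν) →
HasSmoothExtensionPast ν 0 u T; (ii) ∀ L>0, ∀ u, IsBoundedAncientMildSolution 1 u → (slices
measurable) → (slices axisymmetric) → (∀ t<0 ∀ x, |swirl (u t) x| < L) → (∀ t<0 ∀ ε>0, 0 < volume {x
| L−ε < |swirl (u t) x|}) → False. All 8 decls elaborate (Sketch.lean rc 0, 2026-08-15).

## Two-layer plan (D-0019)
Layer 1: cruxes (i)–(iii) typed at open, (iv) informal; supports SwirlSupStrictDecrease (threshold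
structure; provable now modulo decay persistence), SmallSwirlFailureBlowup (proved), ClayUniqueness
(shared), Assembly (proved; superseded as decider by the rev-2 theorem `closes`). Layer 2 (glued
splits, only after a crux closes): (i) ⇐ explicit-constant Lei–Zhang ladder (log-Hardy loss at the
axis made scale-free) / swirl-ray continuity from the in-tree no-swirl theorem; (ii) ⇐ flux capacity
of bounded divergence-free drifts + Harnack for the positive deficit; (iv) ⇐ KNSS sup-zoom +
persistence of swirl at the blow-up scale.

Rationale: WHY THIS LINE. Every full-3-D critical-element programme (route MinimalBlowupRigidity, blocked)
founders on Tao's missing ingredient (3): no controlled critical quantity. The axisymmetric class is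
the one place where such a quantity exists AND comes with a strong maximum principle (LeiZhang2017
"criticality"; ChaeLee2002 L^p-monotonicity of Γ; KNSS2009 §5), and it is also where the only
concrete interior blow-up candidate lives (Hou2022PotentiallySingularNS; Hou2026 proves blow-up only
for a generalised model with solution-dependent viscosity). So ¬A has a one-parameter order
structure there: AxisymBlowup ⇔ Re_c < ∞, with Re_c never attained and time-monotone — the format in
which induction-on-energy arguments run (Kenig–Merle; for NS without a-priori control
RusinSverak2011, GallagherKochPlanchon2013). Imported areas: threshold/critical-element logic
(critical dispersive PDE), strong maximum principle and Liouville/Harnack technology for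
drift–diffusion with divergence-free drift (KNSS2009 Lemma 2.1, LeiRenZhang2019 Nash–Moser and
weighted energy), constant-tracking/certified inequalities for the lower rung. No spectral or
probabilistic reformulation: none sees the swirl structure. What it does that no existing route
does: gives CertifiedBlowup's axisymmetric crux 0727 a decomposition by ORDER PARAMETER with typed
deciders on both sides, and moves the Kenig–Merle idea of MinimalBlowupRigidity to the one class
where the critical norm is a-priori controlled and strictly dissipated (so no minimal element exists
and a critical element is forced to hold its swirl at infinity).
RANKED CRUXES. #2 SmallSwirlRegularity (absolute ε; hardest-informative: decides Re_c > 0; its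
refutation IS AxisymBlowup). #3 SwirlCriticalLiouville (no constant-sup ancient element; strictly
weaker than AX-L; LRZ Thm 1.2 is its rate-ε₀ case). #4 AxisymBlowup (shared spine; construction
side; certified witness ⇒ Re_c ≤ S). #5 SwirlThresholdZoom (informal; compactness; WEAKEST LINK:
axisymmetric singularities are Type II, the KNSS sup-zoom follows |u| not Γ and may lose the swirl
in the limit — Γ̄ ≡ 0 yields only ū = b(s)e_z by KNSS Thm 5.2 — so swirl ≳ 1 must persist at the
blow-up scale, while only the logarithmic axis moduli of LeiZhang2017/Wei2016 are known to be
violated along a blow-up).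
KILL CRITERIA. (a) SwirlThresholdZoom ∧ SwirlCriticalLiouville proved, or AX =
Literature.Analysis.FluidPDE.AxisymmetricSwirlRegularity by any means: AxisymBlowup refuted ⇒ close
`refuted:AxisymBlowup` (CertifiedBlowup breaks too via stmt-0729); #2/#3 survive as theorems of
independent value. (b) SmallSwirlRegularity refuted ⇒ AxisymBlowup holds (SmallSwirlFailureBlowup) ⇒
with X5b the summit is settled negatively. (c) NoBlowup (stmt-0054) proved ⇒ moot. (d) A refuter
derives SwirlCriticalLiouville from print (LZZ arXiv:1701.00868 + LeiRenZhang2019) ⇒ downgrade #3 to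
support and re-rank; a refuter shows SwirlThresholdZoom's normalisation cannot keep the swirl
(swirl-free zoom limits along Hou's run) ⇒ drop #5, the route shrinks to the bracket (#2, #4).
NOT DECOMPOSED. How #2 is proved (explicit Lei–Zhang constants; swirl-ray continuity μ ↦ (u_r, μu_θ,
u_z) off the in-tree theorem axisymmetric_no_swirl_global_regularity_holds); the
Harnack/flux-capacity argument for #3; the typing of #5; everything numerical (Re_Hou from
arXiv:2107.06509 §2, interval verification of weighted Hardy constants) — named as refuter/grounder
tasks inside the items; a Lean constant Re_c (no typed item needs it: SwirlSupStrictDecrease is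
sup-free and #2 quantifies ε directly).
NUMBERS. Re_c ∈ [0,∞]; absolute lower bounds in print: none. LeiZhang2017 Thm 1.4 (p.4, read):
‖Γ₀‖_∞ ≤ δ·M₀⁻¹ with M₀ = (‖ω₀^θ/r‖₂ + ‖(u₀^θ)²/r‖₂)‖Γ₀‖₂; axis moduli: |Γ| ≤ C₁|ln r|^{-2}, r ≤ δ₀
(LZ Cor 1.3), |ln r|^{-3/2} (Wei2016). Liouville side known: Γ → 0 uniformly in r (LZZ), z-periodic
(LRZ Thm 1.1), rate |Γ²−L²| ≤ ε₀L²/r (LRZ Thm 1.2), |u| ≤ C/r (KNSS Thm 5.3, 4 vendored inputs in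
tree); open: no rate, no periodicity. Axisymmetric Type I: excluded (2 theorems). Items at open: 8
(3 typed cruxes + 4 support + assembly), + 1 informal crux = 9 ≤ 15.

Novelty: NOVELTY (searched 2026-08-15 — card audit refuter-novelty-audit-4 (LeiZhang2017 pp.4-5; Goldshtik
1960 / Serrin 1972 / Goldshtik–Shtern JFM 218 (1990) conical "collapse" as the one-number
precedent); this session: `lit search --source zbmath "axially symmetric Navier-Stokes swirl
regularity"` (19 rows incl. NowakowskiZajaczkowski2023, Zajączkowski 2007/2025, LiuZhang2017,
Zhang–Zhang doi:10.1093/imrn/rns232, ChenFangZhang2017, Lei–Ren–Zhang Sci. Sin. 2021, Lei–Ren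
arXiv:2210.01783), `lit frontier NavierStokesRegularity --since 2021` (30 rows, none on axisymmetric
thresholds), `lit read` arXiv:1505.02628 p.4 (Thm 1.2 / Cor 1.3 / Thm 1.4 verbatim),
arXiv:1902.11229 pp.4,10,14 (Thm 1.1/1.2; §4 "limsup_{r→∞}Γ = sup Γ"), arXiv:2302.00730 pp.3-4 ("in
[Ly], [LZ], [ZZ] smallness condition looks very complicated and depends not only on the swirl but
also on e.g. vorticity"); searchd/galaxy intermittently unavailable (rc 75 / queue), OpenAlex and
arXiv API 429.)
Nearest prior art. (a) Threshold / critical-element logic for NS in critical spaces WITHOUT a-priori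
control: RusinSverak2011 (minimal blow-up data in Ḣ^{1/2}), GallagherKochPlanchon2013
(arXiv:1012.0145), Kenig–Koch arXiv:0908.3349; in-tree route MinimalBlowupRigidity. (b) Γ maximum
principle / criticality and RELATIVE small-swirl regularity: ChaeLee2002, LeiZhang2017 (Thm 1.4),
Wei2016, ChenFangZhang2017, LiuZhang2017, NowakowskiZajaczkowski2023 (bounded cylinder, smallness vs
M(T)). (c) Liouville for bounded ancient axisymme  [refs: 10.1093/imrn/rns232, 2210.01783, 1505.02628, 1902.11229, 2302.00730, 1012.0145, 0908.3349, 1701.00868, doi:10.1093/imrn/rns232, LeiZhang2017, NowakowskiZajaczkowski2023, LiuZhang2017, ChenFangZhang2017, RusinSverak2011, GallagherKochPlanchon2013, ChaeLee2002, Wei2016, KNSS2009, LeiZhang2011, LeiRenZhang2019, ZhangPan2022, CarrilloPanZhang2018, Hou2026]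

Barriers (technique_class: swirl-threshold maximum-principle critical-element liouville): BARRIERS (catalogue Literature/Barriers/NavierStokesRegularity/* read 2026-08-15; technique_class:
swirl-threshold maximum-principle critical-element liouville).
- Literature.Barriers.NavierStokesRegularity.AxisymmetricTypeIExclusion: USED, not evaded — any
AxisymBlowup witness is Type II (KNSS2009 Thms 6.1/6.2, SereginSverak2009); hence the compactness
crux SwirlThresholdZoom cannot be Type-I driven (ranked the weakest link) and SwirlCriticalLiouville
is stated for bounded ancient MILD solutions produced by the rate-free KNSS sup-zoom (Prop 6.1), not
for self-similar profiles.
- Literature.Barriers.NavierStokesRegularity.EnergySupercriticality: evaded by restriction of class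
exactly as the catalogue's own evasion (d) records (axisymmetric flows carry the extra
scale-invariant controlled quantity Γ with a maximum principle, LeiZhang2017); SmallSwirlRegularity
and SwirlSupStrictDecrease use sup|Γ| (critical), never the energy; nothing is claimed for general
data. Honest residue: the poloidal field b = (u_r,u_z) stays supercritical — it is the named risk in
#2 (log-Hardy loss at the axis) and #3 (no scale-invariant control of u_r,u_z at large r;
LeiRenZhang2019 p.4).
- Literature.Barriers.NavierStokesRegularity.TaoAveragedBlowup: outside its class — the Γ-equation
is a transport–diffusion identity of the TRUE nonlinearity in a symmetry class (an averaged bilinear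
form has no swirl equation and no maximum principle); the route uses this NS-specific structure
(Tao's "finer struct

History (route lifecycle, newest last):
- 2026-08-15T16:13:14Z · rev 2: dropped AxLiouvilleToSwirlCritical — route-repair(glue+cone): deciding theorem closes : SmallSwirlRegularity → SwirlCriticalLiouville → AxisymBlowup → SwirlThresholdZoom → ClayUniqueness → SwirlSup (planner-rbadge-NavierStokesRegularity-SwirlThr-175b9daa-g4-0)
- 2026-08-25T05:34:13Z · DORMANT — reconciler: no traction for 7.4 d (last activity item-evidence-added at 2026-08-17T19:02:18Z); parked, not closed — `ledger route dormant route-NavierStokesRegu (operator:999:2417401)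
- 2026-08-27T03:05:41Z · REACTIVATED — reconciler: reactivated — activity item-evidence-added at 2026-08-27T02:07:19Z after parking at 2026-08-25T05:34:13Z (operator:999:2512473)
- 2026-09-03T16:18:48Z · DORMANT — reconciler: no traction for 5 d (last activity item-evidence-added at 2026-08-29T15:29:42Z); parked, not closed — `ledger route dormant route-NavierStokesRegula (operator:999:1320253)

sub-problem: NavierStokesRegularity · status: dormant · opened planner-plancard-NavierStokesRegularity-Navie-ac77ef60-0 2026-08-15T11:00:14Z · rev 3 · ledger route-NavierStokesRegularity-SwirlThreshold
GENERATED by the gate from the ledger (D-0016/17). Provers cite these decls: `theorem foo : Summit.NavierStokesRegularity.NavierStokesRegularity.Theses.SwirlThreshold.<Decl> := …` in Summits/NavierStokesRegularity/NavierStokesRegularity/Theorems/<Name>.lean.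
-/

namespace Summit.NavierStokesRegularity.NavierStokesRegularity.Theses.SwirlThreshold

open scoped BigOperators Topology Manifold Classical MeasureTheory ProbabilityTheory Matrix InnerProductSpace ComplexConjugate ContinuousMap
open Filter Set Function TopologicalSpace MeasureTheory

attribute [summit_statement] _root_.NavierStokesRegularity

open Literature.NS

/-- item stmt-NavierStokesRegularity-2002 · crux · rank 2 · open · by planner
why it might fail: Printed small-swirl theorems are all RELATIVE (LeiZhang2017 Thm 1.4: ||Gamma0||oo <= delta/M0; LiuZhang2017; NowakowskiZajaczkowski2023): the 2-D Hardy inequality at the axis loses a log and sup|Gamma| does not control the poloidal field, so an absolute eps may be false (Re_c = 0).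
sources: LeiZhang2017, Wei2016, ChenFangZhang2017, LiuZhang2017, NowakowskiZajaczkowski2023, ChaeLee2002
[crux] ABSOLUTE small-swirl regularity (Re_c > 0): a universal ε > 0 such that for every ν > 0 every
finite-energy (Leray–Hopf) classical solution on [0,T) from a rapidly decaying axisymmetric datum
with sup_x |r u₀^θ| ≤ εν extends past T (sup|Γ| is dimensionless against ν, so the statement is
scale- and ν-consistent). Printed results are all RELATIVE: LeiZhang2017 Thm 1.4 (‖Γ₀‖_∞ ≤ δ·M₀⁻¹,
M₀ = (‖ω₀^θ/r‖₂ + ‖(u₀^θ)²/r‖₂)‖Γ₀‖₂, p.4 read), LiuZhang2017, Zhang–Zhang IMRN 2014,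
NowakowskiZajaczkowski2023 (bounded cylinder; p.4: smallness 'depends not only on the swirl but also
on e.g. vorticity'); the axis-modulus criteria |Γ| ≤ C|ln r|^{-2} (LZ Cor 1.3) and |ln r|^{-3/2}
(Wei2016) are a-priori conditions on the solution. Mechanism to try: the (J, Ω) = (−∂_z u_θ/r,
ω_θ/r) system of ChenFangZhang2017/LeiZhang2017, where sup|Γ| enters linearly through Hardy-type
inequalities at the axis and the 2-D Hardy inequality loses a logarithm — make the loss scale-free
(track and certify the constants), or show it is structural. Two-sided: ¬(this) ⇒ AxisymBlowup
(support SmallSwirlFailureBlowup, proved in the planner's Sketch.lean), hence with X5b ⇒ ¬A. Why it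
might fail: Printed small-swirl theo -/
@[route_item "route-NavierStokesRegularity-SwirlThreshold"]
def SmallSwirlRegularity : Prop :=
  ∃ ε : ℝ, 0 < ε ∧ ∀ (ν T : ℝ), 0 < ν → 0 < T → ∀ (u : ℝ → EuclideanSpace ℝ (Fin 3) → EuclideanSpace ℝ (Fin 3)) (p : ℝ → EuclideanSpace ℝ (Fin 3) → ℝ), Literature.Analysis.FluidPDE.IsClassicalNSSolutionOn (Set.Ico 0 T) ν 0 u p → Literature.Analysis.FluidPDE.IsLerayHopfOn T ν 0 (u 0) u → Literature.Analysis.FluidPDE.HasRapidSpatialDecay (u 0) → Literature.Analysis.FluidPDE.IsAxisymmetric (u 0) → (∀ x, |Literature.Analysis.FluidPDE.swirl (u 0) x| ≤ ε * ν) → Literature.Analysis.FluidPDE.HasSmoothExtensionPast ν 0 u T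

/-- item stmt-NavierStokesRegularity-2003 · crux · rank 3 · open · by planner
why it might fail: Sub-case of the KNSS axisymmetric Liouville problem, open since 2009 (ZhangPan2022 p.12: 'the most difficult' case Gamma non-decaying); known only with |u|<=C/r (KNSS Thm 5.3), z-periodicity or a 1/r rate (LeiRenZhang2019): a constant-sup swirling ancient element might exist (it would refute (L)).
sources: LeiRenZhang2019, arXiv:1701.00868, KNSS2009, LeiZhang2011, ZhangPan2022, CarrilloPanZhang2018
[crux] No swirl-critical ancient element: for L > 0 there is no bounded ancient mild solution u (ν =
1) on ℝ³×(−∞,0), axisymmetric with measurable slices, with |Γ(t,x)| < L everywhere while on EVERY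
slice t < 0 the sets {L − ε < |Γ(t,·)|} have positive measure for all ε > 0 (per-slice swirl
supremum ≡ L, constant in time, never attained — the reservoir at spatial infinity). This is the
shape forced on a singularity model minimal for the swirl threshold (sup strictly dissipated unless
held at infinity; for bounded ancient solutions LeiRenZhang2019 §4 prove limsup_{r→∞}|Γ| = sup|Γ|).
Cone position: (L) = Literature.Analysis.FluidPDE.LiouvilleConjectureNS ⇒ AX-L =
AxisymmetricLiouvilleBoundedSwirl (in tree) ⇒ this (support AxLiouvilleToSwirlCritical); known
sub-cases: Γ → 0 uniformly in r (Lei–Zhang–Zhao arXiv:1701.00868 Thm 1.3), z-periodic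
(LeiRenZhang2019 Thm 1.1), rate |Γ² − L²| ≤ ε₀L²/r (LRZ Thm 1.2), |u| ≤ C/r (KNSS2009 Thm 5.3;
in-tree KNSS2009_swirl_sup_nonpos machinery). Proposed tool: the deficit δ = L − Γ > 0 solves the
same drift–diffusion equation, equals L on the axis and → 0 where the sup is approached; a bounded
divergence-free drift has bounded inflow capacity (flux i -/
@[route_item "route-NavierStokesRegularity-SwirlThreshold"]
def SwirlCriticalLiouville : Prop :=
  ∀ L : ℝ, 0 < L → ∀ u : ℝ → EuclideanSpace ℝ (Fin 3) → EuclideanSpace ℝ (Fin 3), Literature.Analysis.FluidPDE.IsBoundedAncientMildSolution 1 u → (∀ t < 0, MeasureTheory.AEStronglyMeasurable (u t) MeasureTheory.volume) → (∀ t < 0, Literature.Analysis.FluidPDE.IsAxisymmetric (u t)) → (∀ t < 0, ∀ x, |Literature.Analysis.FluidPDE.swirl (u t) x| < L) → (∀ t < 0, ∀ ε : ℝ, 0 < ε → 0 < MeasureTheory.volume {x | L - ε < |Literature.Analysis.FluidPDE.swirl (u t) x|}) → False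

/-- item stmt-NavierStokesRegularity-0727 · crux · rank 4 · open · by planner
why it might fail: AX (Literature.Analysis.FluidPDE.AxisymmetricSwirlRegularity) may simply hold: no-swirl data are global (in-tree theorem), axisymmetric Type I is excluded (KNSS2009, SereginSverak2009), Hou's candidate is numerical and Hou2026 proves blow-up only for a variable-viscosity model.
sources: Hou2022PotentiallySingularNS, Hou2026, KNSS2009, SereginSverak2009, ChenHou2022
X5a_axi: ∃ ν>0, T∈(0,∞) and a classical NS solution (u,p) on ℝ³×[0,T), Leray–Hopf on [0,T), with
u(0) rapidly decaying AND axisymmetric (Literature.Analysis.FluidPDE.IsAxisymmetric), admitting no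
classical extension past T. Strictly stronger than X5a (stmt-NavierStokesRegularity-0152, route
Blowup); isolates the scenario the certified computation targets: Hou's axisymmetric interior nearly
self-similar candidate (arXiv:2107.06509; NB Hou's NS numerics use a degenerate variable viscosity —
constant ν is the claim here), Euler analogue with boundary is a theorem
(Literature.Analysis.FluidPDE.chen_hou_blowup, ChenHou2022). Constraints any construction must
respect: no-swirl data are globally regular
(Literature.Analysis.FluidPDE.axisymmetric_no_swirl_global_regularity) so swirl is essential;
axisymmetric Type I blow-up is excluded (Literature.Analysis.FluidPDE.knss_no_axisymmetric_typeI,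
KNSS2009; Seregin–Šverák 2009) so the rate must be Type II; exactly self-similar finite-local-energy
profiles excluded (necas_ruzicka_sverak, tsai_selfsimilar). Negation follows from the wall
Literature.Analysis.FluidPDE.AxisymmetricSwirlRegularity given X5b. [sources: arXiv:2107.06509,
ChenHou2022, K -/
@[route_item "route-NavierStokesRegularity-SwirlThreshold"]
def AxisymBlowup : Prop :=
  ∃ ν : ℝ, 0 < ν ∧ ∃ T : ℝ, 0 < T ∧ ∃ (u : ℝ → EuclideanSpace ℝ (Fin 3) → EuclideanSpace ℝ (Fin 3)) (p : ℝ → EuclideanSpace ℝ (Fin 3) → ℝ), Literature.Analysis.FluidPDE.IsMaximalSmoothSolution ν 0 u p T ∧ Literature.Analysis.FluidPDE.IsLerayHopfOn T ν 0 (u 0) u ∧ Literature.Analysis.FluidPDE.HasRapidSpatialDecay (u 0) ∧ Literature.Analysis.FluidPDE.IsAxisymmetric (u 0)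

/-- item stmt-NavierStokesRegularity-2119 · crux · rank 5 · open · by planner
why it might fail: Weakest link: axisymmetric blow-up is Type II, the KNSS sup-zoom follows |u| not Gamma and may lose the swirl in the limit (then only u=b(s)e_z, KNSS Thm 5.2); un-zooming needs stability of blow-up under local convergence, false in general (only the global-regular set is open).
sources: KNSS2009, SereginSverak2009, LeiZhang2017, Wei2016, GallagherKochPlanchon2013, Hou2022PotentiallySingularNS
[crux] (INFORMAL until typed; the card's compactness step (S2), the WEAKEST LINK of the route)
SwirlThresholdZoom: AxisymBlowup → for some L > 0 there EXISTS the object that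
SwirlCriticalLiouville forbids — a bounded ancient mild axisymmetric solution (ν = 1) with
measurable slices, |Γ| < L everywhere, and per-slice swirl supremum ≡ L never attained (the sets {L
− ε < |Γ(t,·)|} of positive measure for every t < 0, ε > 0). Intended signature: (verbatim body of
AxisymBlowup) → ∃ L : ℝ, 0 < L ∧ ∃ u, Literature.Analysis.FluidPDE.IsBoundedAncientMildSolution 1 u
∧ (∀ t < 0, AEStronglyMeasurable (u t) volume) ∧ (∀ t < 0, IsAxisymmetric (u t)) ∧ (∀ t < 0, ∀ x,
|swirl (u t) x| < L) ∧ (∀ t < 0, ∀ ε > 0, 0 < volume {x | L − ε < |swirl (u t) x|}) — to be set by a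
grounder/refuter (`ledger workitem set-signature`) once the normalisation below is agreed; with
SwirlCriticalLiouville it yields ¬AxisymBlowup (the kill direction of the route; breaks
CertifiedBlowup via stmt-0729). Intended proof: take AxisymBlowup witnesses and slices with
sup|Γ(u_n(t_n))| ↓ ν·Re_c (threshold-minimising slices exist by SwirlSupStrictDecrease and the
definition of Re_c); KNSS sup-zoom (KNSS2009 Prop 6.1: any finite- -/
@[route_item "route-NavierStokesRegularity-SwirlThreshold"]
def SwirlThresholdZoom : Prop :=
  (∃ ν : ℝ, 0 < ν ∧ ∃ T : ℝ, 0 < T ∧ ∃ (u : ℝ → EuclideanSpace ℝ (Fin 3) → EuclideanSpace ℝ (Fin 3)) (p : ℝ → EuclideanSpace ℝ (Fin 3) → ℝ), Literature.Analysis.FluidPDE.IsMaximalSmoothSolution ν 0 u p T ∧ Literature.Analysis.FluidPDE.IsLerayHopfOn T ν 0 (u 0) u ∧ Literature.Analysis.FluidPDE.HasRapidSpatialDecay (u 0) ∧ Literature.Analysis.FluidPDE.IsAxisymmetric (u 0)) → ∃ L : ℝ, 0 < L ∧ ∃ u : ℝ → EuclideanSpace ℝ (Fin 3) → EuclideanSpace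 ℝ (Fin 3), Literature.Analysis.FluidPDE.IsBoundedAncientMildSolution 1 u ∧ (∀ t < 0, MeasureTheory.AEStronglyMeasurable (u t) MeasureTheory.volume) ∧ (∀ t < 0, Literature.Analysis.FluidPDE.IsAxisymmetric (u t)) ∧ (∀ t < 0, ∀ x, |Literature.Analysis.FluidPDE.swirl (u t) x| < L) ∧ (∀ t < 0, ∀ ε : ℝ, 0 < ε → 0 < MeasureTheory.volume {x | L - ε < |Literature.Analysis.FluidPDE.swirl (u t) x|})

/-- item stmt-NavierStokesRegularity-0153 · support · rank 9 · closed · proved by Summit.NavierStokesRegularity.NavierStokesRegularity.Theorems.adiabaticEddy_clayUniqueness_proof @ bd26efe366a2 (prover) · by planner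
sources: Fefferman2000, Tao2011
Fefferman's class (A) = jointly C^∞ on ℝ³×[0,∞) + sup_t ∫|u|² < ∞; no energy inequality, no decay of
∇u, no integrability in LPS scales is assumed. Claim: such (u,p) coincides on [0,T) with any
Leray–Hopf classical solution v from the same rapidly decaying datum. Expected route: smoothness +
bounded energy ⇒ u is a distributional solution with locally finite dissipation?? (NOT automatic:
∫∫|∇u|² may be infinite) — this is exactly the delicate point; alternatives: Liouville-type control
of the pressure (p harmonic part must be affine ⇒ excluded by bounded energy), then local energy
inequality, then weak–strong uniqueness (Prodi 1959, Serrin 1963) against v which is in every LPS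
class on compacts of [0,T). [sources: Prodi1959, Serrin1963, Fefferman2000, LemarieRieusset2002,
RobinsonRodrigoSadowski2016] -/
@[route_item "route-NavierStokesRegularity-SwirlThreshold"]
def ClayUniqueness : Prop :=
  ∀ ν : ℝ, 0 < ν → ∀ (u₀ : EuclideanSpace ℝ (Fin 3) → EuclideanSpace ℝ (Fin 3)), Literature.Analysis.FluidPDE.HasRapidSpatialDecay u₀ → ∀ (u v : ℝ → EuclideanSpace ℝ (Fin 3) → EuclideanSpace ℝ (Fin 3)) (p q : ℝ → EuclideanSpace ℝ (Fin 3) → ℝ) (T : ℝ), 0 < T → Literature.Analysis.FluidPDE.IsSmoothOnHalfSpace u → Literature.Analysis.FluidPDE.IsSmoothOnHalfSpace p → Literature.Analysis.FluidPDE.IsNavierStokesSolution ν 0 u₀ u p → Literature.Analysis.FluidPDE.HasBoundedEnergy u → Literature.Analysis.FluidPDE.IsClassicalNSSolutionOn (Set.Ico 0 T) ν 0 v q → Literature.Analysis.FluidPDE.IsLerayHopfOn T ν 0 u₀ v → v 0 = u₀ → ∀ t ∈ Set.Ico 0 T, u t = v t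

/-- `ClayUniqueness` holds: proved by `Summit.NavierStokesRegularity.NavierStokesRegularity.Theorems.adiabaticEddy_clayUniqueness_proof` @ bd26efe366a2. -/
theorem ClayUniqueness_holds : ClayUniqueness := _root_.Summit.NavierStokesRegularity.NavierStokesRegularity.Theorems.adiabaticEddy_clayUniqueness_proof

/-- item stmt-NavierStokesRegularity-2004 · support · rank 9 · closed · proved by Summit.NavierStokesRegularity.NavierStokesRegularity.Theorems.SwirlSupStrictDecrease_proof (prover) · by planner
sources: ChaeLee2002, KNSS2009, LeiZhang2017, LemarieRieusset2016
[support] Threshold structure (T1 engine), sup-free form: along a finite-energy classical solution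
on [0,T) from a rapidly decaying axisymmetric datum, for 0 ≤ s < t < T with Γ(s) ≢ 0 there is y with
|Γ(t,x)| < |Γ(s,y)| for all x — i.e. M(t) = sup_x|r u_θ| is STRICTLY decreasing while the swirl is
non-zero. Definitional consequences (no extra item): with Re_c := ν⁻¹ inf{M_u(t) : (u,p,T) an
AxisymBlowup witness, t < T}, every witness has M_u(t) > ν·Re_c for all t < T and the infimum is not
attained (restart at a later slice) — the card's (T1). Proof route: axisymmetry propagates
(uniqueness of Leray–Hopf classical solutions — NB the in-tree isAxisymmetric_of_data assumes
uniform rapid decay, which generic solutions lose, so go through weak–strong uniqueness),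
swirl_transport_holds (in tree), weak and STRONG maximum principle for ∂_t + b·∇ − ν(Δ − (2/r)∂_r)
on {r>0} with Γ = 0 on the axis (KNSS2009 Lemma 2.1 shape), and Γ(t) ∈ C₀, which needs pointwise
spatial decay of u(t) before T (weighted persistence |u(t,x)| ≲ (1+|x|)^{-γ}, γ > 1, Brandolese /
Kukavica–Torres type; rapid decay itself is NOT propagated — generic solutions spread to |x|^{-4}).
Printed neighbours: ChaeLee2002 (‖Γ(t -/
@[route_item "route-NavierStokesRegularity-SwirlThreshold"]
def SwirlSupStrictDecrease : Prop :=
  ∀ (ν T : ℝ), 0 < ν → 0 < T → ∀ (u : ℝ → EuclideanSpace ℝ (Fin 3) → EuclideanSpace ℝ (Fin 3)) (p : ℝ → EuclideanSpace ℝ (Fin 3) → ℝ), Literature.Analysis.FluidPDE.IsClassicalNSSolutionOn (Set.Ico 0 T) ν 0 u p → Literature.Analysis.FluidPDE.IsLerayHopfOn T ν 0 (u 0) u → Literature.Analysis.FluidPDE.HasRapidSpatialDecay (u 0) → Literature.Analysis.FluidPDE.IsAxisymmetric (u 0) → ∀ s t : ℝ, 0 ≤ s → s < t → t < T → (∃ y,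 Literature.Analysis.FluidPDE.swirl (u s) y ≠ 0) → ∃ y, ∀ x, |Literature.Analysis.FluidPDE.swirl (u t) x| < |Literature.Analysis.FluidPDE.swirl (u s) y|

-- `SwirlSupStrictDecrease` holds: proved by `Summit.NavierStokesRegularity.NavierStokesRegularity.Theorems.SwirlSupStrictDecrease_proof` (its module imports this route file, so no `_holds` link can be stated here).

/-- item stmt-NavierStokesRegularity-2005 · support · rank 9 · closed · proved by Summit.NavierStokesRegularity.NavierStokesRegularity.Theorems.smallSwirlFailureBlowup_proof @ 0a1025137642 (prover) · by planner
sources: Fefferman2000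
[support] Two-sidedness glue, PROVED in the planner's Sketch.lean (8 lines, pure logic): the
negation of SmallSwirlRegularity (verbatim) implies AxisymBlowup (verbatim stmt-0727) — take ε = 1;
a non-extendable classical solution on [0,T) is IsMaximalSmoothSolution by definition. Records in
Lean that refuting crux #2 settles the spine. [sources: Fefferman2000] -/
@[route_item "route-NavierStokesRegularity-SwirlThreshold"]
def SmallSwirlFailureBlowup : Prop :=
  (¬ ∃ ε : ℝ, 0 < ε ∧ ∀ (ν T : ℝ), 0 < ν → 0 < T → ∀ (u : ℝ → EuclideanSpace ℝ (Fin 3) → EuclideanSpace ℝ (Fin 3)) (p : ℝ → EuclideanSpace ℝ (Fin 3) → ℝ), Literature.Analysis.FluidPDE.IsClassicalNSSolutionOn (Set.Ico 0 T) ν 0 u p → Literature.Analysis.FluidPDE.IsLerayHopfOn T ν 0 (u 0) u → Literature.Analysis.FluidPDE.HasRapidSpatialDecay (u 0) → Literature.Analysis.FluidPDE.IsAxisymmetric (u 0) → (∀ x, |Literature.Analysis.FluidPDE.swirl (u 0) x| ≤ ε * ν) → Literature.Analysis.FluidPDE.HasSmoothExtensionPast ν 0 u T) → ∃ ν : ℝ,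 0 < ν ∧ ∃ T : ℝ, 0 < T ∧ ∃ (u : ℝ → EuclideanSpace ℝ (Fin 3) → EuclideanSpace ℝ (Fin 3)) (p : ℝ → EuclideanSpace ℝ (Fin 3) → ℝ), Literature.Analysis.FluidPDE.IsMaximalSmoothSolution ν 0 u p T ∧ Literature.Analysis.FluidPDE.IsLerayHopfOn T ν 0 (u 0) u ∧ Literature.Analysis.FluidPDE.HasRapidSpatialDecay (u 0) ∧ Literature.Analysis.FluidPDE.IsAxisymmetric (u 0)

-- `SmallSwirlFailureBlowup` holds: proved by `Summit.NavierStokesRegularity.NavierStokesRegularity.Theorems.smallSwirlFailureBlowup_proof` @ 0a1025137642 (its module imports this route file, so no `_holds` link can be stated here).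

/-- item stmt-NavierStokesRegularity-1154 · assembly · rank 1 · closed · proved by Summit.NavierStokesRegularity.NavierStokesRegularity.Theorems.swirlThreshold_assembly_proof (prover) · by planner
sources: Fefferman2000
[assembly] X5a_axi → X5b → ¬NavierStokesRegularity: the curried form of CertifiedBlowup's Assembly2
(stmt-NavierStokesRegularity-0726, proved by Literature.NS.certifiedBlowup_assembly_v2); one line:
fun h₁ h₂ => certifiedBlowup_assembly_v2 ⟨h₁, h₂⟩ (checked in the planner's Sketch.lean). The
ladder-specific logic (LadderNoFold at n = 3 + HopfSwirlDictionary at m = 1 ⇒ AxisymBlowup; at n = 5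
⇒ HighDimBlowup) becomes glue items once Literature.Analysis.FluidPDE.GeneralizedAxisymNS is
defined. [sources: Fefferman2000] -/
@[route_item "route-NavierStokesRegularity-SwirlThreshold"]
def Assembly : Prop :=
  (∃ ν : ℝ, 0 < ν ∧ ∃ T : ℝ, 0 < T ∧ ∃ (u : ℝ → EuclideanSpace ℝ (Fin 3) → EuclideanSpace ℝ (Fin 3)) (p : ℝ → EuclideanSpace ℝ (Fin 3) → ℝ), Literature.Analysis.FluidPDE.IsMaximalSmoothSolution ν 0 u p T ∧ Literature.Analysis.FluidPDE.IsLerayHopfOn T ν 0 (u 0) u ∧ Literature.Analysis.FluidPDE.HasRapidSpatialDecay (u 0) ∧ Literature.Analysis.FluidPDE.IsAxisymmetric (u 0)) → (∀ ν : ℝ, 0 < ν → ∀ (u₀ : EuclideanSpace ℝ (Fin 3) → EuclideanSpace ℝ (Fin 3)), Literature.Analysis.FluidPDE.HasRapidSpatialDecay u₀ → ∀ (u v : ℝ → EuclideanSpace ℝ (Fin 3) → EuclideanSpace ℝ (Fin 3)) (p q : ℝ → EuclideanSpace ℝ (Fin 3) → ℝ) (T : ℝ), 0 < T → Literature.Analysis.FluidPDE.IsSmoothOnHalfSpace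 u → Literature.Analysis.FluidPDE.IsSmoothOnHalfSpace p → Literature.Analysis.FluidPDE.IsNavierStokesSolution ν 0 u₀ u p → Literature.Analysis.FluidPDE.HasBoundedEnergy u → Literature.Analysis.FluidPDE.IsClassicalNSSolutionOn (Set.Ico 0 T) ν 0 v q → Literature.Analysis.FluidPDE.IsLerayHopfOn T ν 0 u₀ v → v 0 = u₀ → ∀ t ∈ Set.Ico 0 T, u t = v t) → ¬ NavierStokesRegularity

-- `Assembly` holds: proved by `Summit.NavierStokesRegularity.NavierStokesRegularity.Theorems.swirlThreshold_assembly_proof` (its module imports this route file, so no `_holds` link can be stated here).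

/-! D-0027 §2.1 — DECIDING THEOREM (planner-authored via `route open/edit --closes-file`; by planner-rbadge-NavierStokesRegularity-SwirlThr-175b9daa-g4-0 2026-08-15T16:13:14Z):
its hypotheses are this route's items and its conclusion the sub-problem Statement (glue_lint), and it elaborates with this file. -/

@[closes "route-NavierStokesRegularity-SwirlThreshold"] theorem closes (_h₂ : SmallSwirlRegularity) (_h₃ : SwirlCriticalLiouville) (hBlowup : AxisymBlowup)
    (_h₅ : SwirlThresholdZoom) (hUniq : ClayUniqueness) (_s₁ : SwirlSupStrictDecrease)
    (_s₂ : SmallSwirlFailureBlowup) (_hA : Assembly) : ¬ _root_.NavierStokesRegularity :=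
  Literature.NS.certifiedBlowup_assembly_v2 ⟨hBlowup, hUniq⟩

end Summit.NavierStokesRegularity.NavierStokesRegularity.Theses.SwirlThreshold
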